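import Literature.Analysis.Hypoelliptic.WeightedL2
import Mathlib.MeasureTheory.Integral.Prod
import Mathlib.MeasureTheory.Group.Integral
import HarnessLib

/-!
# Kernel operators on the Fourier side: integrability, the classes `InH t` / `Nice`, multipliers and the first commutator gain

Analysis/Hypoelliptic support file, second piece of the Fourier-side toolkit serving the
discharge of `Literature.Analysis.Distribution.Hormander1967_thm11` by Kohn's method
(M. Taylor, *Pseudodifferential Operators* (1981), Ch. XV §1). Continues
`WeightedL2.lean` (weights `bw`, norms `wnorm`, kernel operators `kerOp`, certificates
`KerDecay`, the Schur bound).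

* Row estimates: for a kernel of order `m` and `F` of finite `wnorm t`,
  `∫ ‖K ξ η‖ ‖F η‖ dη ≤ rowConst · ⟨ξ⟩^{m-t} · wnorm t F`; hence `η ↦ K ξ η F η` is integrable
  and `kerOp K F` is everywhere an absolutely convergent integral, polynomially bounded.
* The classes `InH t F` ("`F ∈ Ĥ^t`": a.e. strongly measurable with `wnorm t F < ∞`) and
  `Nice F` ("`F ∈ ⋂_t Ĥ^t`"), stable under kernel operators of finite order and under
  multipliers of polynomial growth; linearity of `kerOp` on these classes.
* Certificates for the kernels built from a certified kernel `K` and a multiplier `φ`: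
  `φ ξ · K ξ η`, `K ξ η · φ η`, convolution kernels `θ (ξ - η)` for rapidly decreasing `θ`
  (`RapidDecay`), and the **first commutator gain**: if the differences of `φ` are of order
  `m₁` (`MulDiff φ m₁ d M`: `‖φ ξ - φ η‖ ≤ d ⟨ξ - η⟩^M ⟨η⟩^{m₁}`), then the commutator
  `[φ, kerOp K] = kerOp ((φ ξ - φ η) K ξ η)` is of order `m₁ + m` — for the symbol `⟨ξ⟩^a`
  one has `m₁ = a - 1`, the classical gain of one derivative (Taylor 1981, Ch. II,
  Thm 4.4 / Cor 4.5 in the pseudo-differential setting; here an elementary kernel statement).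

All constants are explicit functions of the input constants (uniform families stay uniform).

## References

* M. E. Taylor, *Pseudodifferential Operators* (1981), Ch. II §§4, 6; Ch. XV §1.
-/

noncomputable section

open MeasureTheory Set Filter Function
open scoped ENNReal NNReal Topology ComplexConjugate

namespace Literature.Analysis.Hypoelliptic

/-! ### Certificates for multipliers and rapidly decreasing functions -/

section Certs

variable {V : Type*} [NormedAddCommGroup V] [MeasurableSpace V]

/-- **Multiplier of order `m`** with constant `c`: `φ` measurable and `‖φ ξ‖ ≤ c ⟨ξ⟩^m`.
[folklore] -/
structure MulBound (φ : V → ℂ) (m : ℝ) (c : ℝ) : Prop where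
  measurable : Measurable φ
  nonneg : 0 ≤ c
  bound : ∀ ξ, ‖φ ξ‖ ≤ c * bw m ξ

/-- **Differences of order `m₁`** for a multiplier `φ`, with constants `d, M`:
`‖φ ξ - φ η‖ ≤ d ⟨ξ - η⟩^M ⟨η⟩^{m₁}` (for the symbol `⟨ξ⟩^a`: `m₁ = a - 1`, the source of the
commutator gain). [folklore] -/
structure MulDiff (φ : V → ℂ) (m₁ : ℝ) (d M : ℝ) : Prop where
  measurable : Measurable φ
  nonneg : 0 ≤ d
  bound : ∀ ξ η, ‖φ ξ - φ η‖ ≤ d * bw M (ξ - η) * bw m₁ η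

/-- **Rapidly decreasing function** with constants `D`: `‖θ ζ‖ ≤ D N ⟨ζ⟩^{-N}` for all `N`
(e.g. the Fourier transform of a Schwartz function). [folklore] -/
structure RapidDecay (θ : V → ℂ) (D : ℕ → ℝ) : Prop where
  measurable : Measurable θ
  nonneg : ∀ N, 0 ≤ D N
  bound : ∀ (N : ℕ) (ζ : V), ‖θ ζ‖ ≤ D N * bw (-N) ζ

/-- The convolution kernel `(ξ, η) ↦ θ (ξ - η)` (multiplication by `a` on the `x`-side is
convolution by `θ = 𝓕a` on the Fourier side). [folklore] -/
def convKer (θ : V → ℂ) (ξ η : V) : ℂ :=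
  θ (ξ - η)

/-- The adjoint kernel `K†(ξ, η) = conj (K η ξ)`. [folklore] -/
def adjKer (K : V → V → ℂ) (ξ η : V) : ℂ :=
  conj (K η ξ)

omit [MeasurableSpace V] in
/-- `⟨x⟩^M ⟨x⟩^{-(N + ⌈M⌉)} ≤ ⟨x⟩^{-N}`: absorbing a polynomial weight into the decay index.
[folklore] -/
theorem bw_mul_bw_neg_add_ceil_le (M : ℝ) (N : ℕ) (x : V) :
    bw M x * bw (-(N + ⌈M⌉₊ : ℕ)) x ≤ bw (-N) x := by
  rw [← bw_add]
  refine bw_mono ?_ x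
  have := Nat.le_ceil M
  push_cast
  linarith

variable [MeasurableSub₂ V]

/-- A rapidly decreasing `θ` gives a convolution kernel of order `0` with the same constants.
[folklore] -/
theorem RapidDecay.kerDecay_convKer {θ : V → ℂ} {D : ℕ → ℝ} (h : RapidDecay θ D) :
    KerDecay (convKer θ) 0 D where
  measurable := h.measurable.comp (measurable_fst.sub measurable_snd)
  nonneg := h.nonneg
  bound N ξ η := by simpa [convKer] using h.bound N (ξ - η)

omit [MeasurableSub₂ V] in
/-- Right multiplication by a multiplier of order `m'`: `K ξ η · φ η` is of order `m + m'`.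
[folklore] -/
theorem KerDecay.mul_right {K : V → V → ℂ} {m : ℝ} {C : ℕ → ℝ} (hK : KerDecay K m C)
    {φ : V → ℂ} {m' c : ℝ} (hφ : MulBound φ m' c) :
    KerDecay (fun ξ η => K ξ η * φ η) (m + m') (fun N => C N * c) where
  measurable := hK.measurable.mul (hφ.measurable.comp measurable_snd)
  nonneg N := mul_nonneg (hK.nonneg N) hφ.nonneg
  bound N ξ η := by
    rw [norm_mul, bw_add]
    calc ‖K ξ η‖ * ‖φ η‖ ≤ (C N * bw (-N) (ξ - η) * bw m η) * (c * bw m' η) :=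
          mul_le_mul (hK.bound N ξ η) (hφ.bound η) (norm_nonneg _)
            (mul_nonneg (mul_nonneg (hK.nonneg N) (bw_nonneg _ _)) (bw_nonneg _ _))
      _ = C N * c * bw (-N) (ξ - η) * (bw m η * bw m' η) := by ring

omit [MeasurableSub₂ V] in
/-- Left multiplication by a multiplier of order `m'`: `φ ξ · K ξ η` is of order `m' + m`
(Peetre moves the weight from `ξ` to `η` at the cost of decay). [folklore] -/
theorem KerDecay.mul_left {K : V → V → ℂ} {m : ℝ} {C : ℕ → ℝ} (hK : KerDecay K m C)
    {φ : V → ℂ} {m' c : ℝ} (hφ : MulBound φ m' c) :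
    KerDecay (fun ξ η => φ ξ * K ξ η) (m' + m)
      (fun N => 2 ^ (|m'| / 2) * c * C (N + ⌈|m'|⌉₊)) where
  measurable := (hφ.measurable.comp measurable_fst).mul hK.measurable
  nonneg N := mul_nonneg (mul_nonneg (by positivity) hφ.nonneg) (hK.nonneg _)
  bound N ξ η := by
    rw [norm_mul]
    have hP := bw_le_bw_mul_bw_sub m' ξ η
    have h1 : ‖φ ξ‖ ≤ c * (2 ^ (|m'| / 2) * bw m' η * bw |m'| (ξ - η)) :=
      (hφ.bound ξ).trans (mul_le_mul_of_nonneg_left hP hφ.nonneg)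
    have h2 := hK.bound (N + ⌈|m'|⌉₊) ξ η
    have h3 := bw_mul_bw_neg_add_ceil_le |m'| N (ξ - η)
    calc ‖φ ξ‖ * ‖K ξ η‖
        ≤ (c * (2 ^ (|m'| / 2) * bw m' η * bw |m'| (ξ - η))) *
            (C (N + ⌈|m'|⌉₊) * bw (-(N + ⌈|m'|⌉₊ : ℕ)) (ξ - η) * bw m η) :=
          mul_le_mul h1 h2 (norm_nonneg _) (by
            refine mul_nonneg hφ.nonneg (mul_nonneg (mul_nonneg (by positivity)
              (bw_nonneg _ _)) (bw_nonneg _ _)))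
      _ = 2 ^ (|m'| / 2) * c * C (N + ⌈|m'|⌉₊) *
            (bw |m'| (ξ - η) * bw (-(N + ⌈|m'|⌉₊ : ℕ)) (ξ - η)) * (bw m' η * bw m η) := by ring
      _ ≤ 2 ^ (|m'| / 2) * c * C (N + ⌈|m'|⌉₊) * bw (-N) (ξ - η) * (bw m' η * bw m η) :=
          mul_le_mul_of_nonneg_right (mul_le_mul_of_nonneg_left h3
            (mul_nonneg (mul_nonneg (by positivity) hφ.nonneg) (hK.nonneg _)))
            (mul_nonneg (bw_nonneg _ _) (bw_nonneg _ _))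
      _ = 2 ^ (|m'| / 2) * c * C (N + ⌈|m'|⌉₊) * bw (-N) (ξ - η) * bw (m' + m) η := by
          rw [bw_add]

omit [MeasurableSub₂ V] in
/-- **The first commutator gain.** If the differences of `φ` are of order `m₁` and `K` is of
order `m`, the commutator kernel `(φ ξ - φ η) K ξ η` (the kernel of `φ · kerOp K - kerOp K ∘ φ`)
is of order `m₁ + m`. For `φ = ⟨ξ⟩^a` (`m₁ = a - 1`) this is the gain of one derivative in
`[⟨D⟩^a, a(x)]` (Taylor 1981, Ch. II, Cor. 4.5, pseudo-differential version). [folklore] -/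
theorem KerDecay.comm_mul {K : V → V → ℂ} {m : ℝ} {C : ℕ → ℝ} (hK : KerDecay K m C)
    {φ : V → ℂ} {m₁ d M : ℝ} (hφ : MulDiff φ m₁ d M) :
    KerDecay (fun ξ η => (φ ξ - φ η) * K ξ η) (m₁ + m) (fun N => d * C (N + ⌈M⌉₊)) where
  measurable := ((hφ.measurable.comp measurable_fst).sub
    (hφ.measurable.comp measurable_snd)).mul hK.measurable
  nonneg N := mul_nonneg hφ.nonneg (hK.nonneg _)
  bound N ξ η := by
    rw [norm_mul]
    have h1 := hφ.bound ξ η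
    have h2 := hK.bound (N + ⌈M⌉₊) ξ η
    have h3 := bw_mul_bw_neg_add_ceil_le M N (ξ - η)
    calc ‖φ ξ - φ η‖ * ‖K ξ η‖
        ≤ (d * bw M (ξ - η) * bw m₁ η) *
            (C (N + ⌈M⌉₊) * bw (-(N + ⌈M⌉₊ : ℕ)) (ξ - η) * bw m η) :=
          mul_le_mul h1 h2 (norm_nonneg _)
            (mul_nonneg (mul_nonneg hφ.nonneg (bw_nonneg _ _)) (bw_nonneg _ _))
      _ = d * C (N + ⌈M⌉₊) * (bw M (ξ - η) * bw (-(N + ⌈M⌉₊ : ℕ)) (ξ - η)) *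
            (bw m₁ η * bw m η) := by ring
      _ ≤ d * C (N + ⌈M⌉₊) * bw (-N) (ξ - η) * (bw m₁ η * bw m η) :=
          mul_le_mul_of_nonneg_right (mul_le_mul_of_nonneg_left h3
            (mul_nonneg hφ.nonneg (hK.nonneg _))) (mul_nonneg (bw_nonneg _ _) (bw_nonneg _ _))
      _ = d * C (N + ⌈M⌉₊) * bw (-N) (ξ - η) * bw (m₁ + m) η := by rw [bw_add]

omit [MeasurableSub₂ V] in
/-- **Adjoint kernels keep the order**: `K†(ξ, η) = conj (K η ξ)` is of order `m` (Peetre moves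
the weight `⟨ξ⟩^m` to `⟨η⟩^m`). [folklore] -/
theorem KerDecay.adj {K : V → V → ℂ} {m : ℝ} {C : ℕ → ℝ} (hK : KerDecay K m C) :
    KerDecay (adjKer K) m (fun N => 2 ^ (|m| / 2) * C (N + ⌈|m|⌉₊)) where
  measurable := (Complex.continuous_conj.measurable.comp
    (hK.measurable.comp (measurable_snd.prodMk measurable_fst)) : _)
  nonneg N := mul_nonneg (by positivity) (hK.nonneg _)
  bound N ξ η := by
    simp only [adjKer, Complex.norm_conj]
    have h2 := hK.bound (N + ⌈|m|⌉₊) η ξ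
    have hP := bw_le_bw_mul_bw_sub m ξ η
    have h3 := bw_mul_bw_neg_add_ceil_le |m| N (ξ - η)
    rw [bw_sub_comm] at h2
    calc ‖K η ξ‖ ≤ C (N + ⌈|m|⌉₊) * bw (-(N + ⌈|m|⌉₊ : ℕ)) (ξ - η) * bw m ξ := h2
      _ ≤ C (N + ⌈|m|⌉₊) * bw (-(N + ⌈|m|⌉₊ : ℕ)) (ξ - η) *
            (2 ^ (|m| / 2) * bw m η * bw |m| (ξ - η)) :=
          mul_le_mul_of_nonneg_left hP (mul_nonneg (hK.nonneg _) (bw_nonneg _ _))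
      _ = 2 ^ (|m| / 2) * C (N + ⌈|m|⌉₊) *
            (bw |m| (ξ - η) * bw (-(N + ⌈|m|⌉₊ : ℕ)) (ξ - η)) * bw m η := by ring
      _ ≤ 2 ^ (|m| / 2) * C (N + ⌈|m|⌉₊) * bw (-N) (ξ - η) * bw m η :=
          mul_le_mul_of_nonneg_right (mul_le_mul_of_nonneg_left h3
            (mul_nonneg (by positivity) (hK.nonneg _))) (bw_nonneg _ _)

omit [NormedAddCommGroup V] [MeasurableSpace V] in
/-- Unfolding `adjKer`. [folklore] -/
@[simp] theorem adjKer_apply (K : V → V → ℂ) (ξ η : V) : adjKer K ξ η = conj (K η ξ) := rfl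

omit [MeasurableSpace V] in
/-- Unfolding `convKer`. [folklore] -/
@[simp] theorem convKer_apply (θ : V → ℂ) (ξ η : V) : convKer θ ξ η = θ (ξ - η) := rfl

omit [NormedAddCommGroup V] [MeasurableSpace V] in
/-- `K†† = K`. [folklore] -/
@[simp] theorem adjKer_adjKer (K : V → V → ℂ) : adjKer (adjKer K) = K := by
  ext ξ η; simp [adjKer]

end Certs

/-! ### Row estimates and integrability -/

section Rows

variable {V : Type*} [NormedAddCommGroup V] [InnerProductSpace ℝ V] [FiniteDimensional ℝ V]
  [MeasurableSpace V] [BorelSpace V]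

/-- The constant of the row estimate (`a = m - t`):
`2^{|a|/2} · C N₀ · (∫ ⟨ζ⟩^{2(|a| - N₀)} dζ)^{1/2}`, `N₀ = decayIndex a`. [folklore] -/
def rowConst (V : Type*) [NormedAddCommGroup V] [InnerProductSpace ℝ V]
    [FiniteDimensional ℝ V] [MeasurableSpace V] [BorelSpace V] (a : ℝ) (C : ℕ → ℝ) : ℝ :=
  2 ^ (|a| / 2) * C (decayIndex V a) *
    ((∫⁻ ζ : V, ENNReal.ofReal (bw (2 * (|a| - decayIndex V a)) ζ)) ^ (2⁻¹ : ℝ)).toReal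

/-- `rowConst ≥ 0`. [folklore] -/
theorem rowConst_nonneg {C : ℕ → ℝ} (hC : ∀ N, 0 ≤ C N) (a : ℝ) : 0 ≤ rowConst V a C :=
  mul_nonneg (mul_nonneg (by positivity) (hC _)) ENNReal.toReal_nonneg

/-- The integral `∫ ⟨ζ⟩^{2(|a| - N₀)} dζ` of the row estimate is finite. [folklore] -/
theorem lintegral_bw_two_mul_decayIndex_lt_top (a : ℝ) :
    ∫⁻ ζ : V, ENNReal.ofReal (bw (2 * (|a| - decayIndex V a)) ζ) < ∞ := by
  refine lintegral_bw_lt_top ?_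
  have h := abs_sub_decayIndex_lt V a
  have hn : (0 : ℝ) ≤ Module.finrank ℝ V := Nat.cast_nonneg _
  linarith

/-- **The row estimate.** For a kernel of order `m` and any level `t`:
`∫ ‖K ξ η‖ ‖F η‖ dη ≤ rowConst (m - t) C · ⟨ξ⟩^{m-t} · wnorm t F` (Cauchy–Schwarz in `η`
after moving the weight `⟨η⟩^{m-t}` to `ξ` by Peetre). [folklore] -/
theorem KerDecay.lintegral_row_le {K : V → V → ℂ} {m : ℝ} {C : ℕ → ℝ} (h : KerDecay K m C)
    (t : ℝ) {F : V → ℂ} (hF : AEStronglyMeasurable F volume) (ξ : V) :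
    ∫⁻ η, ‖K ξ η‖ₑ * ‖F η‖ₑ ≤
      ENNReal.ofReal (rowConst V (m - t) C * bw (m - t) ξ) * wnorm t F := by
  set a : ℝ := m - t with ha
  set N : ℕ := decayIndex V a with hN
  set c₁ : ℝ := 2 ^ (|a| / 2) * C N * bw a ξ with hc₁
  have hc₁nn : 0 ≤ c₁ := mul_nonneg (mul_nonneg (by positivity) (h.nonneg N)) (bw_nonneg _ _)
  set g₁ : V → ℝ≥0∞ := fun η => ENNReal.ofReal (bw (|a| - N) (ξ - η)) with hg₁
  set g₂ : V → ℝ≥0∞ := fun η => ENNReal.ofReal (bw t η) * ‖F η‖ₑ with hg₂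
  -- pointwise domination
  have hpt : ∀ η, ‖K ξ η‖ₑ * ‖F η‖ₑ ≤ ENNReal.ofReal c₁ * (g₁ η * g₂ η) := fun η => by
    simp only [hg₁, hg₂]
    rw [← mul_assoc, ← mul_assoc, ← ENNReal.ofReal_mul hc₁nn,
      ← ENNReal.ofReal_mul (mul_nonneg hc₁nn (bw_nonneg _ _)), ← ofReal_norm]
    refine mul_le_mul' (ENNReal.ofReal_le_ofReal ?_) le_rfl
    have hb := h.bound N ξ η
    have hP := bw_le_bw_mul_bw_sub' a ξ η
    calc ‖K ξ η‖ ≤ C N * bw (-N) (ξ - η) * bw m η := hb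
      _ = C N * bw (-N) (ξ - η) * (bw a η * bw t η) := by
          rw [← bw_add, show a + t = m by rw [ha]; ring]
      _ ≤ C N * bw (-N) (ξ - η) * ((2 ^ (|a| / 2) * bw a ξ * bw |a| (ξ - η)) * bw t η) :=
          mul_le_mul_of_nonneg_left (mul_le_mul_of_nonneg_right hP (bw_nonneg _ _))
            (mul_nonneg (h.nonneg N) (bw_nonneg _ _))
      _ = c₁ * (bw |a| (ξ - η) * bw (-N) (ξ - η)) * bw t η := by rw [hc₁]; ring
      _ = c₁ * bw (|a| - N) (ξ - η) * bw t η := by rw [← bw_add, ← sub_eq_add_neg]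
  -- Cauchy–Schwarz
  have hg₁m : AEMeasurable g₁ volume := by
    simp only [hg₁]
    exact (ENNReal.measurable_ofReal.comp ((measurable_bw _).comp
      (measurable_const.sub measurable_id))).aemeasurable
  have hg₂m : AEMeasurable g₂ volume :=
    ((ENNReal.measurable_ofReal.comp (measurable_bw t)).aemeasurable.mul hF.enorm)
  have hCS := ENNReal.lintegral_mul_le_Lp_mul_Lq volume Real.HolderConjugate.two_two hg₁m hg₂m
  simp only [one_div] at hCS
  have hI₁ : ∫⁻ η, g₁ η ^ (2 : ℝ) = ∫⁻ ζ : V, ENNReal.ofReal (bw (2 * (|a| - N)) ζ) := by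
    simp only [hg₁]
    rw [lintegral_sub_left_eq_self (fun ζ => ENNReal.ofReal (bw (|a| - N) ζ) ^ (2 : ℝ)) ξ]
    refine lintegral_congr fun ζ => ?_
    rw [ENNReal.rpow_two, sq, ← ENNReal.ofReal_mul (bw_nonneg _ _), ← bw_add, ← two_mul]
  have hI₂ : (∫⁻ η, g₂ η ^ (2 : ℝ)) ^ (2⁻¹ : ℝ) = wnorm t F := by
    rw [wnorm_eq_lintegral]
    simp only [hg₂, ENNReal.rpow_two]
  calc ∫⁻ η, ‖K ξ η‖ₑ * ‖F η‖ₑ ≤ ∫⁻ η, ENNReal.ofReal c₁ * (g₁ η * g₂ η) := lintegral_mono hpt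
    _ = ENNReal.ofReal c₁ * ∫⁻ η, (g₁ * g₂) η := by
        rw [lintegral_const_mul' _ _ ENNReal.ofReal_ne_top]; rfl
    _ ≤ ENNReal.ofReal c₁ * ((∫⁻ η, g₁ η ^ (2 : ℝ)) ^ (2⁻¹ : ℝ) *
          (∫⁻ η, g₂ η ^ (2 : ℝ)) ^ (2⁻¹ : ℝ)) := mul_le_mul' le_rfl hCS
    _ = ENNReal.ofReal (rowConst V a C * bw a ξ) * wnorm t F := by
        rw [hI₁, hI₂, ← mul_assoc, rowConst, ← hN]
        congr 1
        have hfin : (∫⁻ ζ : V, ENNReal.ofReal (bw (2 * (|a| - N)) ζ)) ^ (2⁻¹ : ℝ) ≠ ∞ :=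
          ENNReal.rpow_ne_top_of_nonneg (by norm_num)
            (lintegral_bw_two_mul_decayIndex_lt_top a).ne
        rw [show 2 ^ (|a| / 2) * C N *
            ((∫⁻ ζ : V, ENNReal.ofReal (bw (2 * (|a| - N)) ζ)) ^ (2⁻¹ : ℝ)).toReal * bw a ξ =
            c₁ * ((∫⁻ ζ : V, ENNReal.ofReal (bw (2 * (|a| - N)) ζ)) ^ (2⁻¹ : ℝ)).toReal by
              rw [hc₁]; ring,
          ENNReal.ofReal_mul hc₁nn, ENNReal.ofReal_toReal hfin]

/-- Finiteness of the rows: `∫ ‖K ξ η‖ ‖F η‖ dη < ∞` whenever `wnorm t F < ∞` for some `t`.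
[folklore] -/
theorem KerDecay.lintegral_row_lt_top {K : V → V → ℂ} {m : ℝ} {C : ℕ → ℝ} (h : KerDecay K m C)
    {t : ℝ} {F : V → ℂ} (hF : AEStronglyMeasurable F volume) (hFt : wnorm t F < ∞) (ξ : V) :
    ∫⁻ η, ‖K ξ η‖ₑ * ‖F η‖ₑ < ∞ :=
  (h.lintegral_row_le t hF ξ).trans_lt (ENNReal.mul_lt_top ENNReal.ofReal_lt_top hFt)

/-- **Integrability of the rows**: `η ↦ K ξ η * F η` is integrable for every `ξ` whenever
`wnorm t F < ∞` for some `t`; so `kerOp K F ξ` is an honest absolutely convergent integral.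
[folklore] -/
theorem KerDecay.integrable_mul {K : V → V → ℂ} {m : ℝ} {C : ℕ → ℝ} (h : KerDecay K m C)
    {t : ℝ} {F : V → ℂ} (hF : AEStronglyMeasurable F volume) (hFt : wnorm t F < ∞) (ξ : V) :
    Integrable (fun η => K ξ η * F η) volume := by
  refine ⟨(h.measurable_right ξ).aestronglyMeasurable.mul hF, ?_⟩
  rw [hasFiniteIntegral_iff_enorm]
  calc ∫⁻ η, ‖K ξ η * F η‖ₑ = ∫⁻ η, ‖K ξ η‖ₑ * ‖F η‖ₑ := lintegral_congr fun η => enorm_mul _ _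
    _ < ∞ := h.lintegral_row_lt_top hF hFt ξ

/-- The pointwise polynomial bound: `‖kerOp K F ξ‖ ≤ rowConst · ⟨ξ⟩^{m-t} · wnorm t F`.
[folklore] -/
theorem KerDecay.norm_kerOp_le {K : V → V → ℂ} {m : ℝ} {C : ℕ → ℝ} (h : KerDecay K m C)
    (t : ℝ) {F : V → ℂ} (hF : AEStronglyMeasurable F volume) (hFt : wnorm t F < ∞) (ξ : V) :
    ‖kerOp K F ξ‖ ≤ rowConst V (m - t) C * bw (m - t) ξ * (wnorm t F).toReal := by
  have h1 := (enorm_kerOp_le K F ξ).trans (h.lintegral_row_le t hF ξ)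
  have hc : 0 ≤ rowConst V (m - t) C * bw (m - t) ξ :=
    mul_nonneg (rowConst_nonneg h.nonneg _) (bw_nonneg _ _)
  rw [← ENNReal.ofReal_toReal hFt.ne, ← ENNReal.ofReal_mul hc] at h1
  rw [← ofReal_norm] at h1
  exact (ENNReal.ofReal_le_ofReal_iff (mul_nonneg hc ENNReal.toReal_nonneg)).1 h1

/-- `kerOp K F` is a.e. strongly measurable (indeed strongly measurable after modifying `F` on
a null set). [folklore] -/
theorem KerDecay.aestronglyMeasurable_kerOp {K : V → V → ℂ} {m : ℝ} {C : ℕ → ℝ}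
    (h : KerDecay K m C) {F : V → ℂ} (hF : AEStronglyMeasurable F volume) :
    AEStronglyMeasurable (kerOp K F) volume := by
  obtain ⟨F', hF'm, hFF'⟩ := hF
  rw [kerOp_congr_ae K hFF']
  have hm : StronglyMeasurable (uncurry fun ξ η => K ξ η * F' η) :=
    (h.measurable.mul (hF'm.measurable.comp measurable_snd)).stronglyMeasurable
  exact (hm.integral_prod_right (ν := volume)).aestronglyMeasurable

/-! ### The classes `InH t` and `Nice` -/

/-- `F ∈ Ĥ^t`: a.e. strongly measurable with finite weighted norm of order `t` (the Fourier
image of the Sobolev space `H^t`). [folklore] -/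
def InH (t : ℝ) (F : V → ℂ) : Prop :=
  AEStronglyMeasurable F volume ∧ wnorm t F < ∞

/-- `F ∈ ⋂_t Ĥ^t` (the Fourier image of `H^∞`; contains `𝓕(C_c^∞)` and `𝓢`): the class on
which the a priori estimates are proved. [folklore] -/
def Nice (F : V → ℂ) : Prop :=
  AEStronglyMeasurable F volume ∧ ∀ t : ℝ, wnorm t F < ∞

/-- `Nice F → InH t F`. [folklore] -/
theorem Nice.inH {F : V → ℂ} (h : Nice F) (t : ℝ) : InH t F := ⟨h.1, h.2 t⟩

/-- Lowering the level. [folklore] -/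
theorem InH.mono {F : V → ℂ} {t t' : ℝ} (h : InH t F) (ht : t' ≤ t) : InH t' F :=
  ⟨h.1, (wnorm_mono ht F).trans_lt h.2⟩

/-- `InH` is stable under sums. [folklore] -/
theorem InH.add {F G : V → ℂ} {t : ℝ} (hF : InH t F) (hG : InH t G) :
    InH t (fun ξ => F ξ + G ξ) :=
  ⟨hF.1.add hG.1, (wnorm_add_le hF.1 hG.1).trans_lt (ENNReal.add_lt_top.2 ⟨hF.2, hG.2⟩)⟩

/-- `InH` is stable under negation. [folklore] -/
theorem InH.neg {F : V → ℂ} {t : ℝ} (hF : InH t F) : InH t (fun ξ => -F ξ) :=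
  ⟨hF.1.neg, by rw [wnorm_neg]; exact hF.2⟩

/-- `InH` is stable under differences. [folklore] -/
theorem InH.sub {F G : V → ℂ} {t : ℝ} (hF : InH t F) (hG : InH t G) :
    InH t (fun ξ => F ξ - G ξ) := by
  simpa [sub_eq_add_neg] using hF.add hG.neg

/-- `InH` is stable under scalars. [folklore] -/
theorem InH.const_mul {F : V → ℂ} {t : ℝ} (hF : InH t F) (c : ℂ) :
    InH t (fun ξ => c * F ξ) :=
  ⟨hF.1.const_mul c, by rw [wnorm_const_mul]; exact ENNReal.mul_lt_top enorm_lt_top hF.2⟩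

/-- `Nice` is stable under sums. [folklore] -/
theorem Nice.add {F G : V → ℂ} (hF : Nice F) (hG : Nice G) : Nice (fun ξ => F ξ + G ξ) :=
  ⟨hF.1.add hG.1, fun t => ((hF.inH t).add (hG.inH t)).2⟩

/-- `Nice` is stable under negation. [folklore] -/
theorem Nice.neg {F : V → ℂ} (hF : Nice F) : Nice (fun ξ => -F ξ) :=
  ⟨hF.1.neg, fun t => (hF.inH t).neg.2⟩

/-- `Nice` is stable under differences. [folklore] -/
theorem Nice.sub {F G : V → ℂ} (hF : Nice F) (hG : Nice G) : Nice (fun ξ => F ξ - G ξ) :=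
  ⟨hF.1.sub hG.1, fun t => ((hF.inH t).sub (hG.inH t)).2⟩

/-- `Nice` is stable under scalars. [folklore] -/
theorem Nice.const_mul {F : V → ℂ} (hF : Nice F) (c : ℂ) : Nice (fun ξ => c * F ξ) :=
  ⟨hF.1.const_mul c, fun t => ((hF.inH t).const_mul c).2⟩

/-- The zero function is nice. [folklore] -/
theorem nice_zero : Nice (fun _ : V => (0 : ℂ)) :=
  ⟨aestronglyMeasurable_const, fun t => by simp⟩

/-- **Kernel operators of order `m` map `Ĥ^t` to `Ĥ^{t-m}`.** [folklore] -/
theorem KerDecay.inH_kerOp {K : V → V → ℂ} {m : ℝ} {C : ℕ → ℝ} (h : KerDecay K m C)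
    {t : ℝ} {F : V → ℂ} (hF : InH t F) : InH (t - m) (kerOp K F) :=
  ⟨h.aestronglyMeasurable_kerOp hF.1,
    (wnorm_kerOp_le h t hF.1).trans_lt (ENNReal.mul_lt_top ENNReal.ofReal_lt_top hF.2)⟩

/-- **Kernel operators of finite order preserve the nice class.** [folklore] -/
theorem KerDecay.nice_kerOp {K : V → V → ℂ} {m : ℝ} {C : ℕ → ℝ} (h : KerDecay K m C)
    {F : V → ℂ} (hF : Nice F) : Nice (kerOp K F) :=
  ⟨h.aestronglyMeasurable_kerOp hF.1, fun t => by
    have := (h.inH_kerOp (hF.inH (t + m))).2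
    rwa [add_sub_cancel_right] at this⟩

/-- **Multipliers of order `m` map `Ĥ^t` to `Ĥ^{t-m}`.** [folklore] -/
theorem MulBound.inH_mul {φ : V → ℂ} {m c : ℝ} (h : MulBound φ m c) {t : ℝ} {F : V → ℂ}
    (hF : InH t F) : InH (t - m) (fun ξ => φ ξ * F ξ) :=
  ⟨h.measurable.aestronglyMeasurable.mul hF.1,
    (wnorm_mul_le h.nonneg h.bound t F).trans_lt (ENNReal.mul_lt_top ENNReal.ofReal_lt_top hF.2)⟩

/-- **Multipliers of finite order preserve the nice class.** [folklore] -/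
theorem MulBound.nice_mul {φ : V → ℂ} {m c : ℝ} (h : MulBound φ m c) {F : V → ℂ}
    (hF : Nice F) : Nice (fun ξ => φ ξ * F ξ) :=
  ⟨h.measurable.aestronglyMeasurable.mul hF.1, fun t => by
    have := (h.inH_mul (hF.inH (t + m))).2
    rwa [add_sub_cancel_right] at this⟩

/-! ### Linearity of kernel operators -/

/-- `kerOp K (c F) = c kerOp K F` (no hypothesis). [folklore] -/
theorem kerOp_const_mul (K : V → V → ℂ) (c : ℂ) (F : V → ℂ) :
    kerOp K (fun η => c * F η) = fun ξ => c * kerOp K F ξ := by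
  ext ξ
  simp only [kerOp]
  rw [← integral_const_mul]
  exact integral_congr_ae (Eventually.of_forall fun η => by ring)

/-- `kerOp K (-F) = -kerOp K F`. [folklore] -/
theorem kerOp_neg (K : V → V → ℂ) (F : V → ℂ) :
    kerOp K (fun η => -F η) = fun ξ => -kerOp K F ξ := by
  have h := kerOp_const_mul K (-1) F
  simpa using h

/-- `kerOp (c K) F = c kerOp K F` (no hypothesis). [folklore] -/
theorem kerOp_const_mul_ker (K : V → V → ℂ) (c : ℂ) (F : V → ℂ) :
    kerOp (fun ξ η => c * K ξ η) F = fun ξ => c * kerOp K F ξ := by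
  ext ξ
  simp only [kerOp]
  rw [← integral_const_mul]
  exact integral_congr_ae (Eventually.of_forall fun η => by ring)

/-- Additivity in the argument, for arguments of some finite weighted norm. [folklore] -/
theorem KerDecay.kerOp_add {K : V → V → ℂ} {m : ℝ} {C : ℕ → ℝ} (h : KerDecay K m C)
    {t t' : ℝ} {F G : V → ℂ} (hF : InH t F) (hG : InH t' G) :
    kerOp K (fun η => F η + G η) = fun ξ => kerOp K F ξ + kerOp K G ξ := by
  ext ξ
  simp only [kerOp]
  rw [← integral_add (h.integrable_mul hF.1 hF.2 ξ) (h.integrable_mul hG.1 hG.2 ξ)]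
  exact integral_congr_ae (Eventually.of_forall fun η => by ring)

/-- Subtractivity in the argument. [folklore] -/
theorem KerDecay.kerOp_sub {K : V → V → ℂ} {m : ℝ} {C : ℕ → ℝ} (h : KerDecay K m C)
    {t t' : ℝ} {F G : V → ℂ} (hF : InH t F) (hG : InH t' G) :
    kerOp K (fun η => F η - G η) = fun ξ => kerOp K F ξ - kerOp K G ξ := by
  ext ξ
  simp only [kerOp]
  rw [← integral_sub (h.integrable_mul hF.1 hF.2 ξ) (h.integrable_mul hG.1 hG.2 ξ)]
  exact integral_congr_ae (Eventually.of_forall fun η => by ring)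

/-- Additivity in the kernel. [folklore] -/
theorem KerDecay.kerOp_add_ker {K K' : V → V → ℂ} {m m' : ℝ} {C C' : ℕ → ℝ}
    (h : KerDecay K m C) (h' : KerDecay K' m' C') {t : ℝ} {F : V → ℂ} (hF : InH t F) :
    kerOp (fun ξ η => K ξ η + K' ξ η) F = fun ξ => kerOp K F ξ + kerOp K' F ξ := by
  ext ξ
  simp only [kerOp]
  rw [← integral_add (h.integrable_mul hF.1 hF.2 ξ) (h'.integrable_mul hF.1 hF.2 ξ)]
  exact integral_congr_ae (Eventually.of_forall fun η => by ring)

/-- Subtractivity in the kernel. [folklore] -/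
theorem KerDecay.kerOp_sub_ker {K K' : V → V → ℂ} {m m' : ℝ} {C C' : ℕ → ℝ}
    (h : KerDecay K m C) (h' : KerDecay K' m' C') {t : ℝ} {F : V → ℂ} (hF : InH t F) :
    kerOp (fun ξ η => K ξ η - K' ξ η) F = fun ξ => kerOp K F ξ - kerOp K' F ξ := by
  ext ξ
  simp only [kerOp]
  rw [← integral_sub (h.integrable_mul hF.1 hF.2 ξ) (h'.integrable_mul hF.1 hF.2 ξ)]
  exact integral_congr_ae (Eventually.of_forall fun η => by ring)

/-- Moving a multiplier in the second variable into the kernel: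
`kerOp K (φ F) = kerOp (K ξ η φ η) F` (definitional up to reassociation). [folklore] -/
theorem kerOp_mul_right (K : V → V → ℂ) (φ : V → ℂ) (F : V → ℂ) :
    kerOp K (fun η => φ η * F η) = kerOp (fun ξ η => K ξ η * φ η) F := by
  ext ξ
  simp only [kerOp, mul_assoc]

/-- Moving a multiplier in the first variable out of the kernel:
`kerOp (φ ξ K ξ η) F = φ · kerOp K F`. [folklore] -/
theorem kerOp_mul_left (K : V → V → ℂ) (φ : V → ℂ) (F : V → ℂ) :
    kerOp (fun ξ η => φ ξ * K ξ η) F = fun ξ => φ ξ * kerOp K F ξ := by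
  ext ξ
  simp only [kerOp, mul_assoc]
  exact integral_const_mul _ _

/-- **The commutator of a multiplier with a kernel operator is a kernel operator**:
`φ · kerOp K F - kerOp K (φ F) = kerOp ((φ ξ - φ η) K ξ η) F` for `F` of finite weighted norm
and `φ` of polynomial growth. Combined with `KerDecay.comm_mul` this is the commutator
gain. [folklore] -/
theorem KerDecay.comm_mul_kerOp {K : V → V → ℂ} {m : ℝ} {C : ℕ → ℝ} (h : KerDecay K m C)
    {φ : V → ℂ} {m' c : ℝ} (hφ : MulBound φ m' c) {t : ℝ} {F : V → ℂ} (hF : InH t F) :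
    (fun ξ => φ ξ * kerOp K F ξ - kerOp K (fun η => φ η * F η) ξ) =
      kerOp (fun ξ η => (φ ξ - φ η) * K ξ η) F := by
  have h1 : kerOp (fun ξ η => (φ ξ - φ η) * K ξ η) F =
      kerOp (fun ξ η => φ ξ * K ξ η - K ξ η * φ η) F := by
    congr 1; ext ξ η; ring
  rw [h1, (h.mul_left hφ).kerOp_sub_ker (h.mul_right hφ) hF, kerOp_mul_left, kerOp_mul_right]

end Rows

end Literature.Analysis.Hypoelliptic
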